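import Literature.NumberTheory.EllipticCurves.IwasawaTwistModPTowerExact
import Literature.NumberTheory.GaloisRepresentations.ContinuousH1ResCocycle
import HarnessLib

/-!
# Step 1 of the `μ`-transfer core (`stub_coreX9`, crux 19276): `h mod T = res κ̄' ≠ 0` (memo (F8))

HOME/koly/MU-TRANSFER-PROOF.md §5 STEP 1 with (F4)/(F8), on the `Ω`-adic tower
`ZpExtension.twistTower` (tree): if `κ' ∈ 𝐇¹_Ω` has non-zero constant coefficient
`κ̄' = towerConst κ' ∈ H¹(K, M)` and restriction `H¹(K, M) → H¹(L₀, M)` is injective (Sah, tree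
`galoisCohomology.res_one_injective_of_mem_center`), then any cocycle `φ` representing the level-`J+1`
component `κ'_{J+1}` takes, on `Gal(K̄/L₀)`, a value with non-zero constant coefficient
(`exists_mem_absGaloisFixingSubgroup_apply_zero_ne_zero`): the hypothesis
"`∃ x ∈ im h, x₀ ≠ 0`" of `LevelE.modPTwist_stable_addSubgroup_eq_top_of_apply_zero_ne_zero`.

PARTITION (D-0054): X9 (A4) — helper toward `stub_coreX9`; closes none.
-/

set_option linter.dupNamespace false

noncomputable section

open Literature.NumberTheory.EllipticCurves Literature.NumberTheory.GaloisRepresentations Field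
  Function

universe u

namespace Summit.BirchSwinnertonDyer.BirchSwinnertonDyer.Rank1Residual.LevelE

variable {K : Type u} [Field K] {p : ℕ} [Fact p.Prime] (κ : ZpExtension K p)
  {M : Type u} [AddCommGroup M] [TopologicalSpace M] [DiscreteTopology M]
  (ρ : DiscreteGaloisModule K M) (hM : ∀ x : M, p • x = 0)

/-- The constant coefficient of `κ' ∈ 𝐇¹_Ω` read at any level: `H¹(const_{J+1})(κ'_{J+1}) = κ̄'`.
[cite: MazurRubin2004, §5.3] -/
theorem map_constCoeff_level_eq_towerConst (y : κ.twistTower ρ hM) (J : ℕ) :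
    galoisCohomology.map (κ.twistModPConstCoeff ρ hM (J + 1) (Nat.succ_pos J)) 1 (y.1 (J + 1)) =
      κ.towerConst ρ hM y := by
  rw [κ.map_constCoeff_eq_map_constCoeff_truncH1 ρ hM, y.2 (J + 1) 1, ZpExtension.towerConst_apply]

/-- **`h mod T = res κ̄' ≠ 0` (memo (F8)/STEP 1).** If `κ̄' = towerConst κ' ≠ 0` and
`res : H¹(K, M) → H¹(E, M)` is injective for a normal subextension `E/K` of `K̄/K`, then every cocycle
`φ` representing `κ'_{J+1} ∈ H¹(K, 𝒯_{J+1})` has a value on `Gal(K̄/E)` with non-zero constant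
coefficient. [cite: MazurRubin2004, §5.3] [cite: NeukirchSchmidtWingberg2008, (1.6.7)] -/
theorem exists_mem_absGaloisFixingSubgroup_apply_zero_ne_zero (y : κ.twistTower ρ hM)
    (hy : κ.towerConst ρ hM y ≠ 0) (J : ℕ)
    (φ : contOneCocycles (κ.twistModP ρ hM (J + 1)).toTopRep)
    (hφ : oneCocycleClass (κ.twistModP ρ hM (J + 1)).toTopRep φ = y.1 (J + 1))
    (E : IntermediateField K (AlgebraicClosure K)) [Normal K E]
    (hinj : Injective (galoisCohomology.res ρ E 1)) :
    ∃ τ ∈ absGaloisFixingSubgroup E, φ.1 τ ⟨0, Nat.succ_pos J⟩ ≠ 0 := by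
  have hc : galoisCohomology.map (κ.twistModPConstCoeff ρ hM (J + 1) (Nat.succ_pos J)) 1
      (oneCocycleClass (κ.twistModP ρ hM (J + 1)).toTopRep φ) ≠ 0 := by
    rw [hφ, map_constCoeff_level_eq_towerConst]
    exact hy
  rw [ZpExtension.map_oneCocycleClass_twist] at hc
  obtain ⟨τ, hτ, hne⟩ :=
    galoisCohomology.exists_mem_absGaloisFixingSubgroup_apply_ne_zero ρ E hinj _ hc
  exact ⟨τ, hτ, hne⟩

end Summit.BirchSwinnertonDyer.BirchSwinnertonDyer.Rank1Residual.LevelE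

end
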